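import Literature.NumberTheory.Sieve.FriedlanderIwaniecPrimesJacobiTwistedFlip
import HarnessLib

/-!
# Friedlander–Iwaniec, *The polynomial `X² + Y⁴` captures its primes*, §12: the bilinear-to-quadratic step of Proposition 11.1*

[FI, §12, proof of Proposition 11.1*, p. 46 of arXiv:math/9811185]: after the Möbius step "we see that the
sum (12.5) is bounded by
`∑_ρ ∑_{ℓ∼mD} ∑_{a (mod ℓ)} |∑_{r̄s≡a (mod ℓ)} α_{ρrs}(mℓ/r)| · |∑_{r̄s≡a (mod ℓ)} β_{ρrs}(mℓ/r)|`.
If we denote, for a given `ρ`, the above inner multiple sum by `L(α, β)` then, on applying Cauchy's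
inequality, `L²(α, β) ≤ L(α, α) L(β, β)`."

This file PROVES the two generic facts behind that sentence, in the tree's encoding of the congruence
classes (`r.Coprime ℓ ∧ ℓ ∣ s − a r`, `a ∈ range ℓ`, as in `jtV`):

* `bilinear_congr_eq_sum_classes` — the pairs `(r₁,s₁), (r₂,s₂)` with `(r₁r₂, ℓ) = 1` and
  `r₁s₂ ≡ r₂s₁ (mod ℓ)` are exactly the pairs lying in a common class `s̄₁r₁ ≡ s̄₂r₂ ≡ a (mod ℓ)`:
  `∑_{pairs} x_{r₁s₁} ȳ_{r₂s₂} = ∑_{a (mod ℓ)} (∑_{r̄s≡a} x_{rs}) · conj(∑_{r̄s≡a} y_{rs})`;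
* `sum_norm_sum_mul_conj_le` — Cauchy's inequality over `(ℓ, a)`:
  `∑_ℓ |∑_a X_{ℓa} Ȳ_{ℓa}| ≤ (∑_ℓ ∑_a |X_{ℓa}|²)^{1/2} (∑_ℓ ∑_a |Y_{ℓa}|²)^{1/2}`,
  whose right side is `L(α,α)^{1/2} L(β,β)^{1/2}` with `L(α,α)` a flipped `V` (§12 flip file).

No definitions, no named facts; step 1 of the Prop 12.1 map (HOME/parity-ideate-lit/FI98-Prop121-MAP.md).
-/

noncomputable section

open Finset Real Complex
open scoped NumberTheorySymbols ArithmeticFunction.sigma Nat ComplexConjugate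

namespace Literature.NumberTheory.Sieve.FriedlanderIwaniecPrimes

/-! ### One class meets a coprime pair in the expected congruence -/

/-- For `(r₁, ℓ) = 1` and `s₁ ≡ a r₁ (mod ℓ)`: `s₂ ≡ a r₂ (mod ℓ) ⟺ r₁s₂ ≡ r₂s₁ (mod ℓ)`.
[cite: FriedlanderIwaniecAnnals1998, §12, proof of Proposition 11.1*] -/
theorem dvd_sub_mul_iff_dvd_det {ℓ r₁ s₁ r₂ s₂ a : ℕ} (hr₁ : r₁.Coprime ℓ)
    (ha : (ℓ : ℤ) ∣ (s₁ : ℤ) - (a : ℤ) * r₁) :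
    (ℓ : ℤ) ∣ (s₂ : ℤ) - (a : ℤ) * r₂ ↔ (ℓ : ℤ) ∣ (r₁ : ℤ) * s₂ - (r₂ : ℤ) * s₁ := by
  have key : (r₁ : ℤ) * s₂ - (r₂ : ℤ) * s₁ =
      (r₁ : ℤ) * ((s₂ : ℤ) - (a : ℤ) * r₂) - (r₂ : ℤ) * ((s₁ : ℤ) - (a : ℤ) * r₁) := by ring
  constructor
  · intro h
    rw [key]
    exact dvd_sub (dvd_mul_of_dvd_right h _) (dvd_mul_of_dvd_right ha _)
  · intro h
    have h2 : (ℓ : ℤ) ∣ (r₁ : ℤ) * ((s₂ : ℤ) - (a : ℤ) * r₂) := by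
      have : (r₁ : ℤ) * ((s₂ : ℤ) - (a : ℤ) * r₂) =
          ((r₁ : ℤ) * s₂ - (r₂ : ℤ) * s₁) + (r₂ : ℤ) * ((s₁ : ℤ) - (a : ℤ) * r₁) := by ring
      rw [this]
      exact dvd_add h (dvd_mul_of_dvd_right ha _)
    have hcop : IsCoprime (ℓ : ℤ) (r₁ : ℤ) := by
      rw [Int.isCoprime_iff_gcd_eq_one, Int.gcd_natCast_natCast]
      exact Nat.Coprime.symm hr₁
    exact hcop.dvd_of_dvd_mul_left h2

/-- The class sum over `a (mod ℓ)` of the product of the two class indicators is the indicator of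
`(r₁r₂, ℓ) = 1 ∧ r₁s₂ ≡ r₂s₁ (mod ℓ)`. [cite: FriedlanderIwaniecAnnals1998, §12, proof of Proposition 11.1*] -/
theorem sum_range_ite_class_mul_ite_class {ℓ : ℕ} (hℓ : 0 < ℓ) (r₁ s₁ r₂ s₂ : ℕ) (z : ℂ) :
    ∑ a ∈ range ℓ, (if r₁.Coprime ℓ ∧ (ℓ : ℤ) ∣ (s₁ : ℤ) - (a : ℤ) * r₁ then
        (if r₂.Coprime ℓ ∧ (ℓ : ℤ) ∣ (s₂ : ℤ) - (a : ℤ) * r₂ then z else 0) else 0) =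
      if r₁.Coprime ℓ ∧ r₂.Coprime ℓ ∧ (ℓ : ℤ) ∣ (r₁ : ℤ) * s₂ - (r₂ : ℤ) * s₁ then z else 0 := by
  by_cases hr₁ : r₁.Coprime ℓ
  · have h := sum_range_ite_dvd_sub_mul hℓ hr₁ s₁
      (fun a => if r₂.Coprime ℓ ∧ (ℓ : ℤ) ∣ (s₂ : ℤ) - (a : ℤ) * r₂ then z else 0)
    have h' : ∑ a ∈ range ℓ, (if r₁.Coprime ℓ ∧ (ℓ : ℤ) ∣ (s₁ : ℤ) - (a : ℤ) * r₁ then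
        (if r₂.Coprime ℓ ∧ (ℓ : ℤ) ∣ (s₂ : ℤ) - (a : ℤ) * r₂ then z else 0) else 0) =
        ∑ a ∈ range ℓ, (if (ℓ : ℤ) ∣ (s₁ : ℤ) - (a : ℤ) * r₁ then
        (if r₂.Coprime ℓ ∧ (ℓ : ℤ) ∣ (s₂ : ℤ) - (a : ℤ) * r₂ then z else 0) else 0) := by
      refine sum_congr rfl fun a _ => ?_
      by_cases hd : (ℓ : ℤ) ∣ (s₁ : ℤ) - (a : ℤ) * r₁
      · rw [if_pos ⟨hr₁, hd⟩, if_pos hd]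
      · rw [if_neg (fun h => hd h.2), if_neg hd]
    rw [h', h]
    have hiff := dvd_sub_mul_iff_dvd_det (r₂ := r₂) (s₂ := s₂) hr₁ (dvd_sub_congrSol_mul hℓ hr₁ s₁)
    by_cases hr₂ : r₂.Coprime ℓ
    · by_cases hd : (ℓ : ℤ) ∣ (r₁ : ℤ) * s₂ - (r₂ : ℤ) * s₁
      · rw [if_pos ⟨hr₂, hiff.2 hd⟩, if_pos ⟨hr₁, hr₂, hd⟩]
      · rw [if_neg (fun h => hd (hiff.1 h.2)), if_neg (fun h => hd h.2.2)]
    · rw [if_neg (fun h => hr₂ h.1), if_neg (fun h => hr₂ h.2.1)]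
  · rw [if_neg (fun h => hr₁ h.1)]
    exact sum_eq_zero fun a _ => if_neg fun h => hr₁ h.1

/-! ### The bilinear sum as a sum over classes -/

/-- **Bilinear → classes** [FI, §12, proof of Prop. 11.1*]: for `ℓ ≥ 1`, finite `r`- and `s`-ranges
and vectors `x, y`,
`∑_{a (mod ℓ)} (∑_{(r,ℓ)=1, s ≡ a r (ℓ)} x_{rs}) · conj(∑_{(r,ℓ)=1, s≡ar (ℓ)} y_{rs})
 = ∑_{(r₁,ℓ)=(r₂,ℓ)=1, r₁s₂ ≡ r₂s₁ (mod ℓ)} x_{r₁s₁} · conj(y_{r₂s₂})`.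
[cite: FriedlanderIwaniecAnnals1998, §12, proof of Proposition 11.1*] -/
theorem bilinear_congr_eq_sum_classes {ℓ : ℕ} (hℓ : 0 < ℓ) (Rs Ss : Finset ℕ) (x y : ℕ → ℕ → ℂ) :
    ∑ a ∈ range ℓ,
      (∑ r ∈ Rs, ∑ s ∈ Ss, if r.Coprime ℓ ∧ (ℓ : ℤ) ∣ (s : ℤ) - (a : ℤ) * r then x r s else 0) *
        conj (∑ r ∈ Rs, ∑ s ∈ Ss, if r.Coprime ℓ ∧ (ℓ : ℤ) ∣ (s : ℤ) - (a : ℤ) * r then y r s else 0) =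
    ∑ r₁ ∈ Rs, ∑ s₁ ∈ Ss, ∑ r₂ ∈ Rs, ∑ s₂ ∈ Ss,
      if r₁.Coprime ℓ ∧ r₂.Coprime ℓ ∧ (ℓ : ℤ) ∣ (r₁ : ℤ) * s₂ - (r₂ : ℤ) * s₁ then
        x r₁ s₁ * conj (y r₂ s₂) else 0 := by
  -- expand the product of the two class sums
  have hexp : ∀ a : ℕ,
      (∑ r ∈ Rs, ∑ s ∈ Ss, if r.Coprime ℓ ∧ (ℓ : ℤ) ∣ (s : ℤ) - (a : ℤ) * r then x r s else 0) *
        conj (∑ r ∈ Rs, ∑ s ∈ Ss, if r.Coprime ℓ ∧ (ℓ : ℤ) ∣ (s : ℤ) - (a : ℤ) * r then y r s else 0) =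
      ∑ r₁ ∈ Rs, ∑ s₁ ∈ Ss, ∑ r₂ ∈ Rs, ∑ s₂ ∈ Ss,
        (if r₁.Coprime ℓ ∧ (ℓ : ℤ) ∣ (s₁ : ℤ) - (a : ℤ) * r₁ then
          (if r₂.Coprime ℓ ∧ (ℓ : ℤ) ∣ (s₂ : ℤ) - (a : ℤ) * r₂ then x r₁ s₁ * conj (y r₂ s₂) else 0)
          else 0) := by
    intro a
    rw [map_sum, Finset.sum_mul]
    refine sum_congr rfl fun r₁ _ => ?_
    rw [Finset.sum_mul]
    refine sum_congr rfl fun s₁ _ => ?_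
    rw [Finset.mul_sum]
    refine sum_congr rfl fun r₂ _ => ?_
    rw [map_sum, Finset.mul_sum]
    refine sum_congr rfl fun s₂ _ => ?_
    by_cases h1 : r₁.Coprime ℓ ∧ (ℓ : ℤ) ∣ (s₁ : ℤ) - (a : ℤ) * r₁
    · by_cases h2 : r₂.Coprime ℓ ∧ (ℓ : ℤ) ∣ (s₂ : ℤ) - (a : ℤ) * r₂
      · rw [if_pos h1, if_pos h2, if_pos h2, if_pos h1]
      · rw [if_pos h1, if_neg h2, if_neg h2, map_zero, mul_zero, if_pos h1]
    · rw [if_neg h1, zero_mul, if_neg h1]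
  simp_rw [hexp]
  -- move the `a`-sum inside and evaluate it
  rw [sum_comm]
  refine sum_congr rfl fun r₁ _ => ?_
  rw [sum_comm]
  refine sum_congr rfl fun s₁ _ => ?_
  rw [sum_comm]
  refine sum_congr rfl fun r₂ _ => ?_
  rw [sum_comm]
  refine sum_congr rfl fun s₂ _ => ?_
  exact sum_range_ite_class_mul_ite_class hℓ r₁ s₁ r₂ s₂ _

/-! ### Cauchy's inequality over the classes -/

/-- **Cauchy's inequality over `(ℓ, a)`** [FI, §12: "`L²(α,β) ≤ L(α,α)L(β,β)`"]:
`∑_ℓ |∑_a X_{ℓa} · conj Y_{ℓa}| ≤ (∑_ℓ ∑_a |X_{ℓa}|²)^{1/2} (∑_ℓ ∑_a |Y_{ℓa}|²)^{1/2}`.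
[cite: FriedlanderIwaniecAnnals1998, §12, proof of Proposition 11.1*] -/
theorem sum_norm_sum_mul_conj_le (L : Finset ℕ) (A : ℕ → Finset ℕ) (X Y : ℕ → ℕ → ℂ) :
    ∑ ℓ ∈ L, ‖∑ a ∈ A ℓ, X ℓ a * conj (Y ℓ a)‖ ≤
      Real.sqrt (∑ ℓ ∈ L, ∑ a ∈ A ℓ, ‖X ℓ a‖ ^ 2) * Real.sqrt (∑ ℓ ∈ L, ∑ a ∈ A ℓ, ‖Y ℓ a‖ ^ 2) := by
  have hℓ : ∀ ℓ ∈ L, ‖∑ a ∈ A ℓ, X ℓ a * conj (Y ℓ a)‖ ≤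
      Real.sqrt (∑ a ∈ A ℓ, ‖X ℓ a‖ ^ 2) * Real.sqrt (∑ a ∈ A ℓ, ‖Y ℓ a‖ ^ 2) := by
    intro ℓ _
    have h := norm_sum_mul_sq_le (A ℓ) (fun a => X ℓ a) (fun a => conj (Y ℓ a))
    have hconj : ∑ a ∈ A ℓ, ‖conj (Y ℓ a)‖ ^ 2 = ∑ a ∈ A ℓ, ‖Y ℓ a‖ ^ 2 := by
      refine sum_congr rfl fun a _ => ?_
      rw [Complex.norm_conj]
    rw [hconj] at h
    rw [← Real.sqrt_mul (sum_nonneg fun _ _ => by positivity), ← Real.sqrt_sq (norm_nonneg _)]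
    exact Real.sqrt_le_sqrt h
  calc ∑ ℓ ∈ L, ‖∑ a ∈ A ℓ, X ℓ a * conj (Y ℓ a)‖
      ≤ ∑ ℓ ∈ L, Real.sqrt (∑ a ∈ A ℓ, ‖X ℓ a‖ ^ 2) * Real.sqrt (∑ a ∈ A ℓ, ‖Y ℓ a‖ ^ 2) :=
        sum_le_sum hℓ
    _ ≤ Real.sqrt (∑ ℓ ∈ L, ∑ a ∈ A ℓ, ‖X ℓ a‖ ^ 2) * Real.sqrt (∑ ℓ ∈ L, ∑ a ∈ A ℓ, ‖Y ℓ a‖ ^ 2) :=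
        Real.sum_sqrt_mul_sqrt_le L (fun ℓ => sum_nonneg fun _ _ => by positivity)
          (fun ℓ => sum_nonneg fun _ _ => by positivity)

/-- **The two steps combined** (one `ρ`, the shape used in the proof of Prop. 11.1*): for a range `L` of
moduli `ℓ ≥ 1`,
`∑_{ℓ∈L} |∑_{(r₁r₂,ℓ)=1, r₁s₂≡r₂s₁ (ℓ)} x_{r₁s₁} conj(y_{r₂s₂})| ≤ V_L(x)^{1/2} V_L(y)^{1/2}`,
where `V_L(x) = ∑_{ℓ∈L} ∑_{a (mod ℓ)} |∑_{(r,ℓ)=1, s≡ar (ℓ)} x_{rs}|²` is the (flipped or unflipped,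
according to what was absorbed into `x`) form `V` of §§11–12 over the range `L`.
[cite: FriedlanderIwaniecAnnals1998, §12, proof of Proposition 11.1*] -/
theorem sum_norm_bilinear_congr_le {L : Finset ℕ} (hL : ∀ ℓ ∈ L, 0 < ℓ) (Rs Ss : Finset ℕ)
    (x y : ℕ → ℕ → ℂ) :
    ∑ ℓ ∈ L, ‖∑ r₁ ∈ Rs, ∑ s₁ ∈ Ss, ∑ r₂ ∈ Rs, ∑ s₂ ∈ Ss,
        (if r₁.Coprime ℓ ∧ r₂.Coprime ℓ ∧ (ℓ : ℤ) ∣ (r₁ : ℤ) * s₂ - (r₂ : ℤ) * s₁ then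
          x r₁ s₁ * conj (y r₂ s₂) else 0)‖ ≤
      Real.sqrt (∑ ℓ ∈ L, ∑ a ∈ range ℓ,
          ‖∑ r ∈ Rs, ∑ s ∈ Ss, if r.Coprime ℓ ∧ (ℓ : ℤ) ∣ (s : ℤ) - (a : ℤ) * r then x r s else 0‖ ^ 2) *
        Real.sqrt (∑ ℓ ∈ L, ∑ a ∈ range ℓ,
          ‖∑ r ∈ Rs, ∑ s ∈ Ss, if r.Coprime ℓ ∧ (ℓ : ℤ) ∣ (s : ℤ) - (a : ℤ) * r then y r s else 0‖ ^ 2) := by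
  have h := sum_norm_sum_mul_conj_le L (fun ℓ => range ℓ)
    (fun ℓ a => ∑ r ∈ Rs, ∑ s ∈ Ss, if r.Coprime ℓ ∧ (ℓ : ℤ) ∣ (s : ℤ) - (a : ℤ) * r then x r s else 0)
    (fun ℓ a => ∑ r ∈ Rs, ∑ s ∈ Ss, if r.Coprime ℓ ∧ (ℓ : ℤ) ∣ (s : ℤ) - (a : ℤ) * r then y r s else 0)
  refine le_trans (le_of_eq ?_) h
  refine sum_congr rfl fun ℓ hℓ' => ?_
  rw [bilinear_congr_eq_sum_classes (hL ℓ hℓ') Rs Ss x y]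

end Literature.NumberTheory.Sieve.FriedlanderIwaniecPrimes

end
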